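import Literature.NumberTheory.EllipticCurves.ZpExtension
import Literature.NumberTheory.EllipticCurves.ZpExtensionPadicUnitsProofs
import Literature.NumberTheory.EllipticCurves.IwasawaDualModule
import Literature.NumberTheory.EllipticCurves.GreenbergSelmer
import Literature.NumberTheory.GaloisRepresentations.AbsGaloisGroupCompact
import HarnessLib

/-!
# Pro-`p` descent along a `ℤ_p`-extension: `M^{D ∩ Gal(K̄/K_∞)} = 0` from "`M^D` has no `p`-torsion",
# and "an open subgroup of `Γ_K` containing `Gal(K̄/K_∞)` contains `Gal(K̄/K_n)`" (proved; no definition, no fact)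

Topic `NumberTheory/EllipticCurves` (namespace `Literature.NumberTheory.EllipticCurves.ZpExtension`, the
namespace of the tree's `ℤ_p`-extension lemmas `ZpExtension.pow_mem_layerSubgroup`,
`ZpExtension.mem_range_resOfLe_of_conjH1_eq`).  `Proofs`-style file (theorems only: no `def`, no named fact,
no `sorry`), written by the literature seat `bsd-potss-conjA-anchor` g24 (cell `bsd-potss`; serves the asides
stmt-BirchSwinnertonDyer-19386 / 19413).  It is the Literature home of the generic **pro-`p` descent** that the
summit tree proves privately for the multiplicative rows (`Summit…X11b.AcSelmer.eq_zero_of_fixed_inf_kerSubgroup`,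
cell b2b-bsdres) and that the new (A)-road `FineSelmerTrivialOfSelmerTrivial` needs at the primes above `p`
and at the bad primes; Literature cannot import `Summits/`, so the argument is re-proved here verbatim for an
arbitrary discrete `Γ_K`-module.

* `exists_layerSubgroup_le_of_isOpen_of_kerSubgroup_le` — **an open subgroup `U ≥ Gal(K̄/K_∞)` of `Γ_K`
  contains a layer group `Gal(K̄/K_n) = κ⁻¹(pⁿℤ_p)`**: `U` is normal (`Γ_K/ker κ ≃ ℤ_p` is abelian) of finite
  index `p^a·e`, `p ∤ e`, and `κ(U) ⊇ p^a e ℤ_p = p^a ℤ_p` (`e` is a unit of `ℤ_p`).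
* `normal_of_kerSubgroup_le` (a subgroup above `ker κ` is normal), `exists_generator_mod_layerSubgroup`
  (a generator of `D` modulo a layer: the image of `D` in `ℤ/pⁿ` is cyclic); private copies of the tree's
  `⋂ₙ Gal(K̄/K_n) = Gal(K̄/K_∞)` and `σ^{pⁿ} ∈ Gal(K̄/K_n)` (Kato2004 files) keep the import cone small.
* `eq_zero_of_fixed_of_noPTorsion`, `exists_layerSubgroup_inf_le_stabilizer` (compactness),
  **`eq_zero_of_fixed_inf_kerSubgroup`** — `Γ_K` compact, `M` a discrete `p`-primary `Γ_K`-module with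
  continuous orbit maps and finite `p^k`-torsion for each `k`, `D ≤ Γ_K` closed: if the `D`-fixed points of
  `M` have no `p`-torsion then `M` has NO non-zero point fixed by `D ⊓ ker κ` ("a pro-`p` group acting on a
  non-zero `p`-group has a non-zero fixed point", made effective through the nilpotency of `d₀ − 1`,
  tree `IwasawaDual.pow_mul_prime_pow_apply_eq_zero`).
* `isClosed_decomp` — the decomposition group `GreenbergSelmer.decomp v` is closed; and the curve-free
  corollary `forall_eq_zero_of_fixed_decomp_inf_kerSubgroup` at `D = decomp v`.

References: [SerreLocalFields1979] IX §1 (a `p`-group acting on a `p`-group has a non-trivial fixed point);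
[GreenbergLNM1716] §3 Lemma 3.1 (p. 86 of the held copy `book:coatesnd-arithmetic-theory-elliptic-curves`:
"`E(F_∞)` will have no `p`-torsion, since `Γ = Gal(F_∞/F)` is a pro-`p` group", p. 90); [Washington1997]
§13.1 (`ℤ_p`-extensions: the closed subgroups of `ℤ_p` are `0` and the `pⁿℤ_p`; the layers `K_n`);
[NeukirchANT1999] Ch. II §9 (9.6) (decomposition groups as images of local Galois groups).
-/

noncomputable section

open scoped Classical

open NumberField IsDedekindDomain Field
open Literature.NumberTheory.EllipticCurves Literature.NumberTheory.EllipticCurves.GreenbergSelmer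
open Literature.NumberTheory.GaloisRepresentations

namespace Literature.NumberTheory.EllipticCurves.ZpExtension

variable {K : Type} [Field K] {p : ℕ} [Fact p.Prime] (κ : ZpExtension K p)

/-! ## §1 Layers: `⋂ₙ κ⁻¹(pⁿℤ_p) = ker κ`, `σ^{pⁿ} ∈ κ⁻¹(pⁿℤ_p)`, open subgroups above `ker κ` -/

/-- **`⋂ₙ κ⁻¹(pⁿ ℤ_p) = ker κ`**: an element of every layer subgroup lies in `ker κ = Gal(K̄/K_∞)`
(private copy of the tree's `Kato2004/IwasawaH1ReductionInfty` lemma of the same name, to keep the import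
cone small). [cite: Washington1997, §13.1] -/
private theorem mem_kerSubgroup_of_forall_mem_layerSubgroup' {σ : absoluteGaloisGroup K}
    (h : ∀ n : ℕ, σ ∈ κ.layerSubgroup n) : σ ∈ κ.kerSubgroup := by
  rw [ZpExtension.mem_kerSubgroup]
  have h0 : (κ σ).toAdd = 0 :=
    ZpExtension.PadicUnits.eq_zero_of_forall_pow_dvd fun n ↦ ZpExtension.mem_layerSubgroup.mp (h n)
  exact toAdd_eq_zero.mp h0

/-- `σ^{pⁿ} ∈ κ⁻¹(pⁿ ℤ_p) = Gal(K̄/K_n)` for every `σ ∈ Γ_K` (`κ(σ^{pⁿ}) = pⁿ κ(σ)`; private copy of the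
tree's `Kato2004/IwasawaH1FiniteOfInjectivityProofs` lemma of the same name). [cite: Washington1997, §13.1] -/
private theorem pow_prime_pow_mem_layerSubgroup' (σ : absoluteGaloisGroup K) (n : ℕ) :
    σ ^ p ^ n ∈ κ.layerSubgroup n := by
  rw [ZpExtension.mem_layerSubgroup, map_pow, toAdd_pow, nsmul_eq_mul, Nat.cast_pow]
  exact dvd_mul_right _ _

/-- A natural number prime to `p` is a unit of `ℤ_p`. [folklore] -/
private theorem isUnit_natCast_of_not_dvd {e : ℕ} (he : ¬ p ∣ e) : IsUnit ((e : ℕ) : ℤ_[p]) := by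
  rw [PadicInt.isUnit_iff]
  refine le_antisymm (PadicInt.norm_le_one _) (not_lt.mp fun h ↦ he ?_)
  have h' : ‖((e : ℤ) : ℤ_[p])‖ < 1 := by rwa [Int.cast_natCast]
  rw [PadicInt.norm_int_lt_one_iff_dvd] at h'
  exact_mod_cast h'

/-- A subgroup of `Γ_K` containing `ker κ` is normal (`Γ_K / ker κ ≃ ℤ_p` is abelian). [cite: Washington1997, §13.1] -/
theorem normal_of_kerSubgroup_le (U : Subgroup (absoluteGaloisGroup K)) (hN : κ.kerSubgroup ≤ U) :
    U.Normal := by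
  refine ⟨fun u hu g ↦ ?_⟩
  have hmem : (g * u * g⁻¹) * u⁻¹ ∈ κ.kerSubgroup := by
    rw [ZpExtension.mem_kerSubgroup]
    apply Multiplicative.toAdd.injective
    simp only [map_mul, map_inv, toAdd_mul, toAdd_inv, toAdd_one]
    abel
  have := U.mul_mem (hN hmem) hu
  simpa only [inv_mul_cancel_right] using this

/-- **An open subgroup of `Γ_K` containing `Gal(K̄/K_∞)` contains a layer group `Gal(K̄/K_n)`.**  `Γ_K` is
compact, so an open subgroup `U` has finite index `p^a · e` with `p ∤ e`; `U ⊇ ker κ` is normal, hence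
contains every `(p^a e)`-th power, and since `e` is a unit of `ℤ_p` this gives `κ(U) ⊇ p^a ℤ_p`, i.e.
`κ⁻¹(p^a ℤ_p) ≤ U`.  (Washington: the closed subgroups of `ℤ_p ≃ Gal(K_∞/K)` are `0` and the `pⁿℤ_p`.)
[cite: Washington1997, §13.1] -/
theorem exists_layerSubgroup_le_of_isOpen_of_kerSubgroup_le (U : Subgroup (absoluteGaloisGroup K))
    (hU : IsOpen (U : Set (absoluteGaloisGroup K))) (hN : κ.kerSubgroup ≤ U) :
    ∃ n : ℕ, κ.layerSubgroup n ≤ U := by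
  haveI : CompactSpace (absoluteGaloisGroup K) := absoluteGaloisGroup_compactSpace K
  haveI : Finite (absoluteGaloisGroup K ⧸ U) := Subgroup.quotient_finite_of_isOpen _ hU
  haveI : U.FiniteIndex := Subgroup.finiteIndex_of_finite_quotient
  haveI : U.Normal := normal_of_kerSubgroup_le κ U hN
  have hd : U.index ≠ 0 := Subgroup.FiniteIndex.index_ne_zero
  obtain ⟨a, e, he, hde⟩ := Nat.exists_eq_pow_mul_and_not_dvd hd p (Fact.out : p.Prime).ne_one
  obtain ⟨u, hu⟩ := isUnit_natCast_of_not_dvd (p := p) he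
  refine ⟨a, fun σ hσ ↦ ?_⟩
  obtain ⟨t, ht⟩ := ZpExtension.mem_layerSubgroup.mp hσ
  -- `g` with `κ g = u⁻¹ t`, so that `κ (g ^ index) = p^a e u⁻¹ t = p^a t = κ σ`
  obtain ⟨g, hg⟩ := κ.surjective (Multiplicative.ofAdd ((↑u⁻¹ : ℤ_[p]) * t))
  have hgU : g ^ U.index ∈ U := Subgroup.pow_index_mem U g
  have hg' : κ g = Multiplicative.ofAdd ((↑u⁻¹ : ℤ_[p]) * t) := hg
  have hκ : κ (g ^ U.index) = κ σ := by
    apply Multiplicative.toAdd.injective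
    rw [map_pow, toAdd_pow, hg', toAdd_ofAdd, nsmul_eq_mul, hde, Nat.cast_mul, Nat.cast_pow, ht,
      ← hu]
    simp only [mul_assoc, Units.mul_inv_cancel_left]
  have hker : (g ^ U.index)⁻¹ * σ ∈ κ.kerSubgroup := by
    rw [ZpExtension.mem_kerSubgroup, map_mul, map_inv, hκ, inv_mul_cancel]
  have := U.mul_mem hgU (hN hker)
  rwa [mul_inv_cancel_left] at this

/-- **A generator of `D` modulo a layer.** For any subgroup `D ≤ Γ_K` and `n`, there is `d₀ ∈ D` such that
every `d ∈ D` is `d₀^i · l` with `i ∈ ℤ` and `l ∈ D ∩ κ⁻¹(p^n ℤ_p)`: the image of `D` under the reduction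
`Γ_K → ℤ_p → ℤ/p^n` of `κ` (kernel `κ⁻¹(p^n ℤ_p)`, `PadicInt.ker_toZModPow`) is a subgroup of a cyclic group,
hence cyclic (`Subgroup.isCyclic`). [cite: Washington1997, §13.1] -/
theorem exists_generator_mod_layerSubgroup (D : Subgroup (absoluteGaloisGroup K)) (n : ℕ) :
    ∃ d₀ ∈ D, ∀ d ∈ D, ∃ (i : ℤ) (l : absoluteGaloisGroup K),
      l ∈ D ⊓ κ.layerSubgroup n ∧ d = d₀ ^ i * l := by
  let f : absoluteGaloisGroup K →* Multiplicative (ZMod (p ^ n)) :=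
    (AddMonoidHom.toMultiplicative
      (PadicInt.toZModPow n : ℤ_[p] →+* ZMod (p ^ n)).toAddMonoidHom).comp
      κ.toContinuousMonoidHom.toMonoidHom
  have hf : ∀ σ : absoluteGaloisGroup K, f σ = 1 ↔ σ ∈ κ.layerSubgroup n := fun σ ↦ by
    rw [ZpExtension.mem_layerSubgroup, ← Ideal.mem_span_singleton, ← PadicInt.ker_toZModPow,
      RingHom.mem_ker]
    simp only [f, MonoidHom.coe_comp, Function.comp_apply,
      AddMonoidHom.toMultiplicative_apply_apply, RingHom.toAddMonoidHom_eq_coe,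
      AddMonoidHom.coe_coe, ofAdd_eq_one]
    rfl
  haveI : IsCyclic (D.map f) := Subgroup.isCyclic _
  obtain ⟨g₀, hg₀⟩ := IsCyclic.exists_generator (α := D.map f)
  obtain ⟨d₀, hd₀D, hd₀⟩ := Subgroup.mem_map.mp g₀.2
  refine ⟨d₀, hd₀D, fun d hd ↦ ?_⟩
  obtain ⟨i, hi⟩ := Subgroup.mem_zpowers_iff.mp (hg₀ ⟨f d, Subgroup.mem_map_of_mem _ hd⟩)
  have hi' : f d = f d₀ ^ i := by
    have := congrArg Subtype.val hi
    simp only [SubgroupClass.coe_zpow] at this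
    rw [← this, hd₀]
  have hl : (d₀ ^ i)⁻¹ * d ∈ κ.layerSubgroup n := by
    rw [← hf, map_mul, map_inv, map_zpow, hi', inv_mul_cancel]
  exact ⟨i, (d₀ ^ i)⁻¹ * d, Subgroup.mem_inf.mpr ⟨D.mul_mem (D.inv_mem (D.zpow_mem hd₀D i)) hd, hl⟩,
    (mul_inv_cancel_left _ _).symm⟩

/-! ## §2 Pro-`p` descent along a `ℤ_p`-extension -/

section Generic

variable {M : Type} [AddCommGroup M] [DistribMulAction (absoluteGaloisGroup K) M]
  [TopologicalSpace M] [DiscreteTopology M]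

omit [Fact p.Prime] [TopologicalSpace M] [DiscreteTopology M] in
/-- **(1) A `p`-primary `D`-module whose `D`-fixed points have no `p`-torsion has NO non-zero `D`-fixed
point** (if `p^{k+1} m = 0` then `p^k m` is fixed and `p`-torsion, so `0`; induct).
[cite: SerreLocalFields1979, IX.§1 (p-groups acting on p-groups)] [cite: GreenbergLNM1716, §3 p. 90] -/
theorem eq_zero_of_fixed_of_noPTorsion (D : Subgroup (absoluteGaloisGroup K))
    (h0 : ∀ m : M, (∀ d ∈ D, d • m = m) → p • m = 0 → m = 0)
    {k : ℕ} : ∀ {m : M}, (∀ d ∈ D, d • m = m) → p ^ k • m = 0 → m = 0 := by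
  induction k with
  | zero => intro m _ hm; rwa [pow_zero, one_smul] at hm
  | succ k ih =>
    intro m hm hpk
    refine ih hm ?_
    refine h0 _ (fun d hd ↦ ?_) ?_
    · rw [smul_comm, hm d hd]
    · rw [← mul_smul, ← pow_succ', hpk]

/-- **(2) Compactness: some layer of `D` fixes a given finite set of `D ⊓ ker κ`-fixed points.** For
`D ≤ Γ_K` closed and a finite set `A ⊆ M` of elements fixed by `D ⊓ ker κ` (continuous orbit maps, `M`
discrete), there is `n` such that every `d ∈ D ∩ κ⁻¹(p^n ℤ_p)` fixes `A` pointwise: the closed sets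
`(D ∩ κ⁻¹(p^nℤ_p)) ∖ V`, `V` the open pointwise stabiliser of `A`, decrease to `(D ∩ ker κ) ∖ V = ∅` in the
compact group `Γ_K`. [cite: Washington1997, §13.1] -/
theorem exists_layerSubgroup_inf_le_stabilizer (D : Subgroup (absoluteGaloisGroup K))
    (hD : IsClosed (D : Set (absoluteGaloisGroup K)))
    (hcont : ∀ m : M, Continuous fun g : absoluteGaloisGroup K ↦ g • m) {A : Set M}
    (hA : A.Finite) (hAN : ∀ a ∈ A, ∀ g ∈ D ⊓ κ.kerSubgroup, g • a = a) :
    ∃ n : ℕ, ∀ g ∈ D ⊓ κ.layerSubgroup n, ∀ a ∈ A, g • a = a := by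
  haveI : CompactSpace (absoluteGaloisGroup K) := absoluteGaloisGroup_compactSpace K
  set V : Set (absoluteGaloisGroup K) := ⋂ a ∈ A, {g | g • a = a} with hV
  have hVopen : IsOpen V :=
    hA.isOpen_biInter fun a _ ↦ (isOpen_discrete ({a} : Set M)).preimage (hcont a)
  set F : ℕ → Set (absoluteGaloisGroup K) := fun n ↦ (κ.layerSubgroup n : Set _) ∩ Vᶜ with hF
  have hFclosed : ∀ n, IsClosed (F n) := fun n ↦
    ((κ.layerSubgroup n).isClosed_of_isOpen (κ.isOpen_layerSubgroup n)).inter hVopen.isClosed_compl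
  have hFdir : Directed (· ⊇ ·) F := fun i j ↦ ⟨max i j,
    Set.inter_subset_inter_left _ (κ.layerSubgroup_antitone (le_max_left i j)),
    Set.inter_subset_inter_left _ (κ.layerSubgroup_antitone (le_max_right i j))⟩
  have hempty : (D : Set (absoluteGaloisGroup K)) ∩ ⋂ n, F n = ∅ := by
    rw [Set.eq_empty_iff_forall_notMem]
    rintro g ⟨hgD, hgF⟩
    rw [Set.mem_iInter] at hgF
    have hgker : g ∈ κ.kerSubgroup :=
      mem_kerSubgroup_of_forall_mem_layerSubgroup' κ fun n ↦ (hgF n).1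
    have hgV : g ∈ V := by
      rw [hV, Set.mem_iInter₂]
      exact fun a ha ↦ hAN a ha g (Subgroup.mem_inf.mpr ⟨hgD, hgker⟩)
    exact (hgF 0).2 hgV
  obtain ⟨n, hn⟩ := hD.isCompact.elim_directed_family_closed F hFclosed hempty hFdir
  refine ⟨n, fun g hg a ha ↦ ?_⟩
  obtain ⟨hgD, hgL⟩ := Subgroup.mem_inf.mp hg
  have hgV : g ∈ V := by
    by_contra hgV
    have : g ∈ (D : Set (absoluteGaloisGroup K)) ∩ F n := ⟨hgD, hgL, hgV⟩
    rw [hn] at this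
    exact this
  rw [hV, Set.mem_iInter₂] at hgV
  exact hgV a ha

/-- **Pro-`p` descent along a `ℤ_p`-extension.** `Γ_K` compact; `M` a discrete `Γ_K`-module with continuous
orbit maps, `p`-primary, with finite `p^k`-torsion for each `k`; `D ≤ Γ_K` closed; `N = D ⊓ ker κ`
(`ker κ = Gal(K̄/K_∞)`).  If the `D`-fixed points of `M` have no `p`-torsion, then **`M^N = 0`**: every `m ∈ M`
fixed by `N` is `0`.  (A pro-`p` group — here `D/N ↪ Gal(K_∞/K) ≃ ℤ_p` — acting on a non-zero discrete
`p`-primary module has a non-zero fixed point: (2) a layer of `D` fixes the finite `D`-stable set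
`A = M^N ∩ M[p^k] ∋ m`, (3) `D` is generated modulo that layer by one `d₀`, (4) `(d₀ − 1)^{k pⁿ} m = 0`
(`IwasawaDual.pow_mul_prime_pow_apply_eq_zero`) and peeling one factor `d₀ − 1` at a time gives `m = 0`
by (1).)  The summit tree's `X11b.AcSelmer.eq_zero_of_fixed_inf_kerSubgroup`, re-homed in Literature.
[cite: SerreLocalFields1979, IX.§1 (Lemma: a `p`-group acting on a `p`-group fixes a nonzero element)]
[cite: GreenbergLNM1716, §3 Lemma 3.1 (p. 86) and p. 90 (`Γ` pro-`p` ⟹ no new `p`-torsion up the tower)] -/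
theorem eq_zero_of_fixed_inf_kerSubgroup (D : Subgroup (absoluteGaloisGroup K))
    (hD : IsClosed (D : Set (absoluteGaloisGroup K)))
    (hcont : ∀ m : M, Continuous fun g : absoluteGaloisGroup K ↦ g • m)
    (htor : ∀ m : M, ∃ k : ℕ, p ^ k • m = 0)
    (hfin : ∀ k : ℕ, Set.Finite {m : M | p ^ k • m = 0})
    (h0 : ∀ m : M, (∀ d ∈ D, d • m = m) → p • m = 0 → m = 0)
    {m : M} (hm : ∀ g ∈ D ⊓ κ.kerSubgroup, g • m = m) : m = 0 := by
  obtain ⟨k, hk⟩ := htor m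
  -- the finite `D`-stable set `A = M^N ∩ M[p^k]`
  set A : Set M := {a | p ^ k • a = 0 ∧ ∀ g ∈ D ⊓ κ.kerSubgroup, g • a = a} with hAdef
  have hAfin : A.Finite := (hfin k).subset fun a ha ↦ ha.1
  have hmA : m ∈ A := ⟨hk, hm⟩
  have hAstab : ∀ d ∈ D, ∀ a ∈ A, d • a ∈ A := by
    intro d hd a ha
    refine ⟨by rw [smul_comm, ha.1, smul_zero], fun g hg ↦ ?_⟩
    obtain ⟨hgD, hgker⟩ := Subgroup.mem_inf.mp hg
    have hc : d⁻¹ * g * d ∈ D ⊓ κ.kerSubgroup := by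
      refine Subgroup.mem_inf.mpr ⟨D.mul_mem (D.mul_mem (D.inv_mem hd) hgD) hd, ?_⟩
      rw [ZpExtension.mem_kerSubgroup] at hgker ⊢
      rw [map_mul, map_mul, map_inv, hgker, mul_one, inv_mul_cancel]
    have key := ha.2 _ hc
    rw [mul_smul, mul_smul] at key
    have key' := congrArg (d • ·) key
    simpa only [smul_inv_smul] using key'
  have hAsub : ∀ a ∈ A, ∀ b ∈ A, a - b ∈ A := fun a ha b hb ↦
    ⟨by rw [smul_sub, ha.1, hb.1, sub_zero], fun g hg ↦ by rw [smul_sub, ha.2 g hg, hb.2 g hg]⟩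
  -- (2) a layer of `D` fixing `A`
  obtain ⟨n, hn⟩ := exists_layerSubgroup_inf_le_stabilizer κ D hD hcont hAfin
    (fun a ha g hg ↦ ha.2 g hg)
  -- (3) a generator `d₀` of `D` modulo that layer: `D`-fixed on `A` = fixed by `d₀`
  obtain ⟨d₀, hd₀D, hgen⟩ := exists_generator_mod_layerSubgroup κ D n
  have hfixD : ∀ a ∈ A, d₀ • a = a → ∀ d ∈ D, d • a = a := by
    intro a ha hfix d hd
    obtain ⟨i, l, hl, rfl⟩ := hgen d hd
    have hzpow : d₀ ^ i ∈ MulAction.stabilizer (absoluteGaloisGroup K) a :=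
      Subgroup.zpow_mem _ (MulAction.mem_stabilizer_iff.mpr hfix) i
    rw [mul_smul, hn l hl a ha, MulAction.mem_stabilizer_iff.mp hzpow]
  -- (4) `(d₀ - 1)` is nilpotent on `m`: `d₀^{p^n}` fixes `m`, `p^k m = 0`
  set T : AddMonoid.End M := DistribMulAction.toAddMonoidEnd (absoluteGaloisGroup K) M d₀ with hT
  have hTapply : ∀ x : M, T x = d₀ • x := fun x ↦ rfl
  have hTpow : ∀ (j : ℕ) (x : M), (T ^ j) x = d₀ ^ j • x := fun j x ↦ by
    rw [hT, ← map_pow]; rfl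
  have hTfix : (T ^ p ^ n) m = m := by
    rw [hTpow]
    exact hn _ (Subgroup.mem_inf.mpr ⟨D.pow_mem hd₀D _, pow_prime_pow_mem_layerSubgroup' κ d₀ n⟩)
      m hmA
  have hnil : ((T - 1) ^ (k * p ^ n)) m = 0 :=
    IwasawaDual.pow_mul_prime_pow_apply_eq_zero (Fact.out : p.Prime) T n hTfix hk
  have hTsubA : ∀ a ∈ A, (T - 1) a ∈ A := fun a ha ↦ by
    rw [IwasawaDual.End_sub_apply, AddMonoid.End.one_apply, hTapply]
    exact hAsub _ (hAstab d₀ hd₀D a ha) _ ha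
  have hpeel : ∀ (e : ℕ), ∀ a ∈ A, ((T - 1) ^ e) a = 0 → a = 0 := by
    intro e
    induction e with
    | zero => intro a _ h; simpa using h
    | succ e ih =>
      intro a ha h
      rw [pow_succ, AddMonoid.End.coe_mul, Function.comp_apply] at h
      have h1 : (T - 1) a = 0 := ih _ (hTsubA a ha) h
      rw [IwasawaDual.End_sub_apply, AddMonoid.End.one_apply, hTapply, sub_eq_zero] at h1
      exact eq_zero_of_fixed_of_noPTorsion D h0 (hfixD a ha h1) ha.1
  exact hpeel _ m hmA hnil

/-- **Pro-`p` descent, finite `p`-torsion coefficients.** For a FINITE discrete `Γ_K`-module `M` killed by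
`p` (e.g. `E[p]`) with continuous orbit maps and `D ≤ Γ_K` closed: `M^D = 0 ⟹ M^{D ⊓ Gal(K̄/K_∞)} = 0`.
[cite: SerreLocalFields1979, IX.§1] [cite: GreenbergLNM1716, §3 p. 90] -/
theorem eq_zero_of_fixed_inf_kerSubgroup_of_finite [Finite M] (D : Subgroup (absoluteGaloisGroup K))
    (hD : IsClosed (D : Set (absoluteGaloisGroup K)))
    (hcont : ∀ m : M, Continuous fun g : absoluteGaloisGroup K ↦ g • m)
    (hpM : ∀ m : M, p • m = 0)
    (h0 : ∀ m : M, (∀ d ∈ D, d • m = m) → m = 0)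
    {m : M} (hm : ∀ g ∈ D ⊓ κ.kerSubgroup, g • m = m) : m = 0 :=
  eq_zero_of_fixed_inf_kerSubgroup κ D hD hcont (fun x ↦ ⟨1, by rw [pow_one]; exact hpM x⟩)
    (fun _ ↦ Set.toFinite _) (fun x hx _ ↦ h0 x hx) hm

end Generic

/-! ## §3 Decomposition groups -/

variable [NumberField K]

omit [Fact p.Prime] in
/-- The decomposition group `D_v ≤ Γ_K` of the chosen prime above `v` (`GreenbergSelmer.decomp v`, the image
of `Γ_{K_v}`) is closed: the continuous image of the compact group `Γ_{K_v}`.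
[cite: NeukirchANT1999, Ch. II §9 Prop. (9.6)] -/
theorem isClosed_decomp (v : HeightOneSpectrum (𝓞 K)) :
    IsClosed (decomp v : Set (absoluteGaloisGroup K)) := by
  haveI : CompactSpace (absoluteGaloisGroup (v.adicCompletion K)) :=
    absoluteGaloisGroup_compactSpace (v.adicCompletion K)
  exact (isCompact_range (absGaloisRestrict K (v.adicCompletion K)).continuous).isClosed

/-- **`M^{D_v} = 0 ⟹ M^{D_v ⊓ Gal(K̄/K_∞)} = 0`** for a finite discrete `Γ_K`-module `M` killed by `p` with
continuous orbit maps, at the decomposition group `D_v = GreenbergSelmer.decomp v` of a finite place `v` and ANY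
`ℤ_p`-extension `κ` of the number field `K`: "`E(K_v)[p] = 0 ⟹ E(K_{∞,w})[p] = 0`", the local torsion
hypothesis (c3) of Deo–Ray–Sujatha carried up the cyclotomic tower.
[cite: GreenbergLNM1716, §3 p. 90 (`Γ` pro-`p`)] [cite: DeoRaySujatha2023, §3 Thm. 3.9 (c3) (arXiv:2202.09937 p. 10)] -/
theorem forall_eq_zero_of_fixed_decomp_inf_kerSubgroup {M : Type} [AddCommGroup M]
    [DistribMulAction (absoluteGaloisGroup K) M] [TopologicalSpace M] [DiscreteTopology M] [Finite M]
    (hcont : ∀ m : M, Continuous fun g : absoluteGaloisGroup K ↦ g • m) (hpM : ∀ m : M, p • m = 0)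
    (v : HeightOneSpectrum (𝓞 K)) (h0 : ∀ m : M, (∀ d ∈ decomp v, d • m = m) → m = 0) :
    ∀ m : M, (∀ g ∈ decomp v ⊓ κ.kerSubgroup, g • m = m) → m = 0 := fun _ hm ↦
  eq_zero_of_fixed_inf_kerSubgroup_of_finite κ (decomp v) (isClosed_decomp v) hcont hpM h0 hm

end Literature.NumberTheory.EllipticCurves.ZpExtension

end
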